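import Mathlib
import HarnessLib
import Literature.MathematicalPhysics.QuantumLattice.LiebFluxPhaseProofs
import Summits.HubbardSuperconductivity.HubbardSuperconductivity.Theorems.WeakCouplingBCSWcbcsBcsConstructionGcGroundEnergyEqMin

/-!
# Route `ThermalWedge`, item `stmt-HubbardSuperconductivity-1702` (`TwPureThermalBound`):
# reduction to canonical/grand-canonical GROUND-ENERGY equivalence

Support file (`--supports stmt-HubbardSuperconductivity-1702`; no definition; the route file is not
imported — the conclusion is the VERBATIM BODY of `ThermalWedge.TwPureThermalBound`).

`TwPureThermalBound` asks, for `δ ∈ [1/10, 2/5]`, small `U > 0`, every `β ≥ 1`, for a chemical potential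
`μ` in a `δ`-uniform compact of `(−4, 0)` with `e_L + p_L(β,μ) − μ N_L/L² ≤ log 4/β + ε` eventually in
`L`, where `e_L = minEnergyOn(hubbardTorus 2 L 1 U, szSector N_L 0)/L²`, `N_L = 2⌊(1−δ)L²/2⌋`, and
`p_L = log Z_β(hubbardTorusWith 2 L 1 U μ)/(βL²)`. Since `Z_β(K) ≤ dim · e^{−βE₀(K)}` (`dim = 4^{L²}`,
tree `partitionFn_le_card_mul_exp`) and `E₀(H − μN) = min_{N'} (E(N') − μN')` over the particle-number
sectors (tree `stub_gcGroundEnergyEqMin`, `E(N') = groundEnergyAt`), the item follows — with the SAME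
`μ` for every `β` — from the `T = 0` statement

  (GSEE) `E^{(N_L, S^z=0)}_L − μN_L ≤ E_L(N') − μN' + εL²` for all sectors `N'`, eventually in `L`,

i.e. the `(N_L, S^z = 0)` ground energy of the canonical torus lies within `o(L²)` of the lower supporting
line of slope `μ` of the sector energies: `twPureThermalBound_of_gsee`. (GSEE) is the thermodynamic-limit
content (equivalence of ensembles at `T = 0`; Ruelle 1969 §3), proved in the sibling files.
-/

set_option linter.dupNamespace false

noncomputable section

namespace Summit.HubbardSuperconductivity.HubbardSuperconductivity.Theorems

open Literature.MathematicalPhysics.QuantumLattice Literature.Probability.LatticeModels Matrix Finset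
open scoped Matrix.Norms.L2Operator ComplexOrder

/-- The Fock space of the `L × L` torus has dimension `4^{L²}`: `log dim = L² log 4`. [folklore] -/
theorem ptb_log_card_fock (L : ℕ) :
    Real.log (Fintype.card (Finset (Orb (FermionTorus 2 L))) : ℝ) = (L : ℝ) ^ 2 * Real.log 4 := by
  have hcard : Fintype.card (FermionTorus 2 L) = L ^ 2 := by simp [FermionTorus]
  rw [Fintype.card_finset, card_orb, hcard]
  push_cast
  rw [Real.log_pow]
  have h4 : Real.log 4 = 2 * Real.log 2 := by
    rw [show (4 : ℝ) = 2 ^ 2 by norm_num, Real.log_pow]; norm_num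
  rw [h4]
  push_cast
  ring

/-- **Entropy bound for the grand-canonical torus pressure**: for `β > 0`,
`log Z_β(H − μN) ≤ L² log 4 − β E₀(H − μN)`. [folklore] -/
theorem ptb_log_partitionFn_le (L : ℕ) (U μ β : ℝ) (hβ : 0 < β) :
    Real.log (partitionFn β (hubbardTorusWith 2 L 1 U μ)).re ≤
      (L : ℝ) ^ 2 * Real.log 4 - β * (hubbardTorusWith 2 L 1 U μ).groundEnergy := by
  have hH : (hubbardTorusWith 2 L 1 U μ).IsHermitian := isHermitian_hamiltonianWith _ 1 U μ
  have hZ := partitionFn_le_card_mul_exp hH hβ.le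
  have hpos : 0 < (partitionFn β (hubbardTorusWith 2 L 1 U μ)).re := by
    have h := partitionFn_pos β hH
    exact (Complex.pos_iff.mp h).1
  have hcard : (0 : ℝ) < Fintype.card (Finset (Orb (FermionTorus 2 L))) := by exact_mod_cast Fintype.card_pos
  calc Real.log (partitionFn β (hubbardTorusWith 2 L 1 U μ)).re
      ≤ Real.log (Fintype.card (Finset (Orb (FermionTorus 2 L))) *
          Real.exp (-(β * (hubbardTorusWith 2 L 1 U μ).groundEnergy))) := Real.log_le_log hpos hZ
    _ = (L : ℝ) ^ 2 * Real.log 4 - β * (hubbardTorusWith 2 L 1 U μ).groundEnergy := by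
        rw [Real.log_mul hcard.ne' (Real.exp_pos _).ne', Real.log_exp, ptb_log_card_fock]; ring

/-- **A uniform lower bound on the sector energies bounds the grand-canonical ground energy from
below**: if `M ≤ E(N') − μN'` for every `N' ≤ 2L²`, then `M ≤ E₀(H − μN)`. [folklore] -/
theorem ptb_le_groundEnergy_of_forall_sector (L : ℕ) (U μ M : ℝ)
    (h : ∀ N' : ℕ, N' ≤ 2 * Fintype.card (FermionTorus 2 L) →
      M ≤ groundEnergyAt (fermionTorusGraph 2 L) 1 U N' - μ * N') :
    M ≤ (hubbardTorusWith 2 L 1 U μ).groundEnergy := by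
  have hT : (hubbardTorusWith 2 L 1 U μ).groundEnergy =
      ⨅ N : Fin (2 * Fintype.card (FermionTorus 2 L) + 1),
        (groundEnergyAt (fermionTorusGraph 2 L) 1 U (N : ℕ) - μ * ((N : ℕ) : ℝ)) := by
    -- `convert`: the `DecidableEq` instance found on the concrete torus differs syntactically from the
    -- generic `LinearOrder.toDecidableEq` carried by the tree lemma
    unfold hubbardTorusWith
    convert stub_gcGroundEnergyEqMin (fermionTorusGraph 2 L) 1 U μ using 2
  rw [hT]
  exact le_ciInf fun N => h N (Nat.lt_succ_iff.mp N.isLt)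

/-- **`TwPureThermalBound` from ground-energy ensemble equivalence.** If for every `δ ∈ [1/10, 2/5]`
there are `−4 < μ₁ ≤ μ₂ < 0` and `U₀ > 0` such that for `0 < U ≤ U₀` some `μ ∈ [μ₁, μ₂]` satisfies
(GSEE) — `E^{(N_L,0)}_L − μN_L ≤ E_L(N') − μN' + εL²` for all `N' ≤ 2L²`, eventually in `L` — then the
verbatim body of `ThermalWedge.TwPureThermalBound` holds (`Z ≤ 4^{L²}e^{−βE₀}`, `E₀ = min_{N'}(E(N') − μN')`).
[folklore] -/
theorem twPureThermalBound_of_gsee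
    (hGSEE : ∀ δ ∈ Set.Icc (1/10 : ℝ) (2/5 : ℝ), ∃ μ₁ μ₂ : ℝ, -4 < μ₁ ∧ μ₁ ≤ μ₂ ∧ μ₂ < 0 ∧ ∃ U₀ : ℝ, 0 < U₀ ∧
      ∀ U ∈ Set.Ioc (0 : ℝ) U₀, ∃ μ ∈ Set.Icc μ₁ μ₂, ∀ ε : ℝ, 0 < ε → ∃ L₀ : ℕ, ∀ (L : ℕ) [NeZero L], L₀ ≤ L →
        ∀ N' : ℕ, N' ≤ 2 * Fintype.card (FermionTorus 2 L) →
          (hubbardTorus 2 L 1 U).minEnergyOn (szSector (Λ := FermionTorus 2 L) (2 * ⌊(1 - δ) * (L : ℝ) ^ 2 / 2⌋₊) 0)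
              - μ * ((2 * ⌊(1 - δ) * (L : ℝ) ^ 2 / 2⌋₊ : ℕ) : ℝ) ≤
            groundEnergyAt (fermionTorusGraph 2 L) 1 U N' - μ * N' + ε * (L : ℝ) ^ 2) :
    ∀ δ ∈ Set.Icc (1/10 : ℝ) (2/5 : ℝ), ∃ μ₁ μ₂ : ℝ, -4 < μ₁ ∧ μ₁ ≤ μ₂ ∧ μ₂ < 0 ∧ ∃ U₀ : ℝ, 0 < U₀ ∧ ∀ U ∈ Set.Ioc (0 : ℝ) U₀, ∀ β : ℝ, 1 ≤ β → ∃ μ ∈ Set.Icc μ₁ μ₂, ∀ ε : ℝ, 0 < ε → ∃ L₀ : ℕ, ∀ (L : ℕ) [NeZero L], L₀ ≤ L → ((Literature.MathematicalPhysics.QuantumLattice.hubbardTorus 2 L 1 U).minEnergyOn (Literature.MathematicalPhysics.QuantumLattice.szSector (Λ := Literature.MathematicalPhysics.QuantumLattice.FermionTorus 2 L) (2 * ⌊(1 - δ) * (L : ℝ) ^ 2 / 2⌋₊) 0) / (L : ℝ) ^ 2) + (Real.log (Matrix.partitionFn β (Literature.MathematicalPhysics.QuantumLattice.hubbardTorusWith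 2 L 1 U μ)).re / (β * (L : ℝ) ^ 2)) - μ * ((2 * ⌊(1 - δ) * (L : ℝ) ^ 2 / 2⌋₊) : ℝ) / (L : ℝ) ^ 2 ≤ Real.log 4 / β + ε := by
  intro δ hδ
  obtain ⟨μ₁, μ₂, h1, h2, h3, U₀, hU₀, hU⟩ := hGSEE δ hδ
  refine ⟨μ₁, μ₂, h1, h2, h3, U₀, hU₀, fun U hUm β hβ => ?_⟩
  obtain ⟨μ, hμ, hε⟩ := hU U hUm
  refine ⟨μ, hμ, fun ε hεp => ?_⟩
  obtain ⟨L₀, hL⟩ := hε ε hεp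
  refine ⟨L₀, fun L _ hLL => ?_⟩
  have hβ0 : 0 < β := lt_of_lt_of_le one_pos hβ
  have hL0 : (L : ℝ) ≠ 0 := by exact_mod_cast NeZero.ne L
  have hLpos : (0 : ℝ) < (L : ℝ) ^ 2 := by positivity
  have hβne : β ≠ 0 := (lt_of_lt_of_le one_pos hβ).ne'
  set M : ℝ := (hubbardTorus 2 L 1 U).minEnergyOn
    (szSector (Λ := FermionTorus 2 L) (2 * ⌊(1 - δ) * (L : ℝ) ^ 2 / 2⌋₊) 0) with hM
  set NL : ℕ := 2 * ⌊(1 - δ) * (L : ℝ) ^ 2 / 2⌋₊ with hNL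
  -- the grand-canonical ground energy is within `εL²` of `M − μN_L`
  have hE0 : M - μ * (NL : ℝ) - ε * (L : ℝ) ^ 2 ≤ (hubbardTorusWith 2 L 1 U μ).groundEnergy :=
    ptb_le_groundEnergy_of_forall_sector L U μ _ fun N' hN' => by
      have := hL L hLL N' hN'
      linarith
  -- entropy bound
  have hlog := ptb_log_partitionFn_le L U μ β hβ0
  have hβL : 0 < β * (L : ℝ) ^ 2 := mul_pos hβ0 hLpos
  have hp : Real.log (partitionFn β (hubbardTorusWith 2 L 1 U μ)).re / (β * (L : ℝ) ^ 2) ≤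
      Real.log 4 / β - (M - μ * (NL : ℝ) - ε * (L : ℝ) ^ 2) / (L : ℝ) ^ 2 := by
    rw [div_le_iff₀ hβL]
    have e1 : (Real.log 4 / β - (M - μ * (NL : ℝ) - ε * (L : ℝ) ^ 2) / (L : ℝ) ^ 2) * (β * (L : ℝ) ^ 2) =
        (L : ℝ) ^ 2 * Real.log 4 - β * (M - μ * (NL : ℝ) - ε * (L : ℝ) ^ 2) := by
      field_simp
    rw [e1]
    have := mul_le_mul_of_nonneg_left hE0 hβ0.le
    linarith
  have e2 : (M - μ * (NL : ℝ) - ε * (L : ℝ) ^ 2) / (L : ℝ) ^ 2 =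
      M / (L : ℝ) ^ 2 - μ * (NL : ℝ) / (L : ℝ) ^ 2 - ε := by
    field_simp
  rw [e2] at hp
  have hgoal : M / (L : ℝ) ^ 2 + Real.log (partitionFn β (hubbardTorusWith 2 L 1 U μ)).re / (β * (L : ℝ) ^ 2) -
      μ * (NL : ℝ) / (L : ℝ) ^ 2 ≤ Real.log 4 / β + ε := by linarith
  simpa [hM, hNL] using hgoal

end Summit.HubbardSuperconductivity.HubbardSuperconductivity.Theorems

end
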